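import Summits.CriticalPhenomena.CardyFormulaZ2.Theorems.SegmentOpen.Negative.NormOne
import Summits.CriticalPhenomena.CardyFormulaZ2.Theorems.CardySelfDualSegmentQuarterTurnPinning
import Summits.CriticalPhenomena.CardyFormulaZ2.Theorems.CardySelfDualSegmentSmirnovBasePoint
import Literature.Probability.LatticeModels.TriangularLatticeProofs

/-!
# `SegmentOpen` (stmt-CriticalPhenomena-5471): the modulus is pinned at both ends — frozen-modulus
# strengthenings of the crux are false

Negative-side support for the crux `CardySelfDualSegment.SegmentOpen` (cdisprove unit, cycle 2; work
file `Cruxes/SegmentOpen/Disproof.lean`).  Write `G_α = {t | CardyMod t α}` for the good set AT A FIXED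
MODULUS `α`, so that the crux's good set is `G = ⋃_{im α > 0} G_α`, a DISJOINT union by modulus
uniqueness (`modulus_unique'`, file `NormOne`).  Using only landed theorems of this route's cone
(`smirnovBasePoint_proof`, item 5474; `quarterTurnPinning_proof`, item 5475) we prove:

* `modulus_zero_eq_triZeta`, `modulus_one_eq_I` — the modulus function of `G` is PINNED at both
  endpoints: `α(0) = ζ = e^{iπ/3}` and `α(1) = i` (whenever `0`, resp. `1`, is good at all);
  hence `one_not_mem_goodSetAt_triZeta`, `zero_not_mem_goodSetAt_I`.
* `not_exists_frozen_modulus` — **the quantifiers of the Target cannot be swapped**: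
  `¬ ∃ α, 0 < im α ∧ ∀ t, CardyMod t α`.  Linear universality along the corner segment with ONE
  linear map is false; any proof of `SegmentOpen`/`Target` must let the shear `φ_α` MOVE with `t`
  (this is the formal content of the route's "moving modulus" design, cf. barrier
  `CoveringLatticeShift`, where Beffara's interpolation keeps the modulus `i` fixed).
* `not_forall_isOpen_goodSetAt_of_target` — **openness cannot be proved modulus-by-modulus**:
  if the route's `Target` holds then the fixed-modulus good sets `G_α` are NOT all open (they would
  disconnect `[0,1]`: `G_ζ ∋ 0` would be clopen and miss `1`).  So the natural strengthening
  "`UM → ∀ α, IsOpen G_α`" of the crux is incompatible with the very statement the route wants.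
* `cardyMod'_of_im_eq_zero` — the side condition `0 < im α` of the crux is load-bearing in the
  cheap direction: for a REAL `α` the shear `φ_α` collapses `ℂ` onto `ℝ`, no conformal rectangle is
  a `φ_α`-image, and `CardyMod t α` holds VACUOUSLY; without `0 < im α` the good set would be all of
  `[0,1]` for trivial reasons (`exists_cardyMod'_real`).  (`im α < 0` is equivalent to `im α > 0` by
  `cardyModOf_conj`.)

Refs: V. Beffara, Progr. Probab. 60 (2008), §2.2 and Prop. 4; R. Langlands, P. Pouliot,
Y. Saint-Aubin, Bull. AMS 30 (1994) §2.4 (linear universality conjecture); S. Smirnov (2001).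
-/

noncomputable section

namespace Summit.CriticalPhenomena.CardyFormulaZ2.Theorems.SegmentOpen.Negative

open Set Filter Topology Complex
open UpperHalfPlane (upperHalfPlaneSet)
open Literature.Probability.RandomPlanarGeometry
open Literature.Barriers.CriticalPhenomena
open Literature.Probability.Percolation (cornerCrossingProb cornerCrossingProb_eq cornerPercolation
  cornerPercolation_one bondPercolation embDomainCrossing half)
open Literature.Probability.LatticeModels (triZeta triZeta_re triZeta_im squareLatticeEmbedding zdGraph)
open Summit.CriticalPhenomena.CardyFormulaZ2.Theses.CardySelfDualSegment (Target)

/-! ## §0 Fixed-modulus good sets and a transport lemma -/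

/-! Below, the good set of the corner family AT A FIXED MODULUS `α` is written out as
`{t : unitInterval | CardyMod' (cornerCrossingProb t) α}` (= `G_α` of the docstrings); the crux's
good set is `{t | ∃ α, 0 < im α ∧ t ∈ G_α}`. -/

/-- Two marked-domain presentations with the same carrier and the same marked points have
uniformizing data of equal cross-ratio (`IsUniformizing` only sees `carrier` and `pt`). [folklore] -/
theorem crossRatio_eq_of_carrier_eq'' {R D : ConformalRectangle} (hc : R.carrier = D.carrier)
    (hp : ∀ i, R.pt i = D.pt i)
    {φ : ConformalEquiv upperHalfPlaneSet R.carrier} {x : Fin 4 → ℝ} (h : R.IsUniformizing φ x)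
    {ψ : ConformalEquiv upperHalfPlaneSet D.carrier} {y : Fin 4 → ℝ} (h' : D.IsUniformizing ψ y) :
    crossRatio x = crossRatio y := by
  have key : ∀ (S : Set ℂ) (hS : S = D.carrier) (φ' : ConformalEquiv upperHalfPlaneSet S),
      ((StrictMono x ∨ StrictAnti x) ∧ ∀ i, φ'.HasBoundaryValue (x i) (R.pt i)) →
        crossRatio x = crossRatio y := by
    intro S hS φ' hφ'
    subst hS
    have hu : D.IsUniformizing φ' x := ⟨hφ'.1, fun i => by rw [← hp i]; exact hφ'.2 i⟩
    exact ConformalRectangle.crossRatio_eq_of_isUniformizing_holds hu h'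
  exact key R.carrier hc φ h

/-! ## §1 The endpoints: `α(0) = ζ` (Smirnov base point) and `α(1) = i` (quarter-turn pinning) -/

/-- The Smirnov base point in template form: `0 ∈ G_ζ` (item 5474, proved in tree).
[cite: Smirnov2001, Thm. 1] -/
theorem zero_mem_goodSetAt_triZeta : (0 : unitInterval) ∈ {t : unitInterval | CardyMod' (cornerCrossingProb t) triZeta} :=
  fun R R' φ x hc hp hu => smirnovBasePoint_proof R R' φ x hc hp hu

/-- Quarter-turn pinning in template form: if `1` is good at all, then `1 ∈ G_i` — the crude
bond-`ℤ²` crossing probabilities converge to Cardy's value in every conformal rectangle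
(item 5475, proved in tree; `φ_i = id`). [cite: Beffara2008Universal, §2.2] -/
theorem one_mem_goodSetAt_I (h : ∃ α : ℂ, 0 < α.im ∧ CardyMod' (cornerCrossingProb 1) α) :
    (1 : unitInterval) ∈ {t : unitInterval | CardyMod' (cornerCrossingProb t) I} := by
  have hq : ∀ R : ConformalRectangle, R.HasCrossingLimit (fun δ => (bondPercolation (zdGraph 2) half).real
      (embDomainCrossing squareLatticeEmbedding.z R.carrier δ (R.arc 0) (R.arc 2)))
      Literature.Probability.RandomPlanarGeometry.cardyFunction :=
    quarterTurnPinning_proof h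
  intro R R' φ x hc hp hu
  have hc' : R.carrier = R'.carrier := by
    rw [hc]
    refine (image_congr fun z _ => moduliShear_I_apply z).trans ?_
    exact image_id' _
  have hp' : ∀ i, R.pt i = R'.pt i := fun i => by rw [hp i, moduliShear_I_apply]
  obtain ⟨ψ, y, hψ⟩ := MarkedDomain.exists_isUniformizing_holds R'
  have e : crossRatio x = crossRatio y := crossRatio_eq_of_carrier_eq'' hc' hp' hu hψ
  have t := hq R' ψ y hψ
  have hP : cornerCrossingProb 1 R' = fun δ => (bondPercolation (zdGraph 2) half).real
      (embDomainCrossing squareLatticeEmbedding.z R'.carrier δ (R'.arc 0) (R'.arc 2)) := by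
    funext δ
    rw [cornerCrossingProb_eq, cornerPercolation_one]
  rw [e, hP]
  exact t

/-- **`α(1) = i`**: the only modulus of the upper half-plane that can witness `1 ∈ G` is `i`.
[cite: Beffara2008Universal, §2.2] -/
theorem modulus_one_eq_I {α : ℂ} (hα : 0 < α.im) (h : CardyMod' (cornerCrossingProb 1) α) : α = I :=
  modulus_unique' hα (by simp) h (one_mem_goodSetAt_I ⟨α, hα, h⟩)

/-- **`α(0) = ζ`**: the only modulus of the upper half-plane that can witness `0 ∈ G` is
Smirnov's `ζ = e^{iπ/3}`. [cite: Smirnov2001, Thm. 1] -/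
theorem modulus_zero_eq_triZeta {α : ℂ} (hα : 0 < α.im) (h : CardyMod' (cornerCrossingProb 0) α) :
    α = triZeta :=
  modulus_unique' hα (by rw [triZeta_im]; positivity) h zero_mem_goodSetAt_triZeta

/-- `ζ ≠ i` (real parts `1/2 ≠ 0`). [folklore] -/
theorem triZeta_ne_I : triZeta ≠ I := by
  intro h
  have := congrArg Complex.re h
  rw [triZeta_re, Complex.I_re] at this
  norm_num at this

/-- `1 ∉ G_ζ`: Smirnov's shear is the WRONG linear map for bond-`ℤ²`. [cite: Beffara2008Universal, §2.2] -/
theorem one_not_mem_goodSetAt_triZeta : (1 : unitInterval) ∉ {t : unitInterval | CardyMod' (cornerCrossingProb t) triZeta} := fun h =>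
  triZeta_ne_I (modulus_one_eq_I (by rw [triZeta_im]; positivity) h)

/-- `0 ∉ G_i`: the identity shear is the wrong linear map for the corner model `M_0` (site-`𝕋` in the
square frame). [cite: Smirnov2001, Thm. 1] -/
theorem zero_not_mem_goodSetAt_I : (0 : unitInterval) ∉ {t : unitInterval | CardyMod' (cornerCrossingProb t) I} := fun h =>
  triZeta_ne_I (modulus_zero_eq_triZeta (by simp) h).symm

/-! ## §2 Frozen-modulus strengthenings are false -/

/-- **No frozen modulus** (refutation of the `∃∀` strengthening of the route's Target
`∀ t ∃ α`): no single `α` of the upper half-plane gives Cardy limits after `φ_α` for every `M_t`,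
`t ∈ [0,1]` — the modulus is `ζ` at `t = 0` and `i` at `t = 1`.  Any proof of `SegmentOpen` must
therefore move the shear with `t`. [folklore] -/
theorem not_exists_frozen_modulus :
    ¬ ∃ α : ℂ, 0 < α.im ∧ ∀ t : unitInterval, CardyMod' (cornerCrossingProb t) α := by
  rintro ⟨α, hα, h⟩
  exact triZeta_ne_I ((modulus_zero_eq_triZeta hα (h 0)).symm.trans (modulus_one_eq_I hα (h 1)))

/-- Equivalent set form: no fixed-modulus good set is all of `[0,1]`. [folklore] -/
theorem goodSetAt_ne_univ {α : ℂ} (hα : 0 < α.im) : {t : unitInterval | CardyMod' (cornerCrossingProb t) α} ≠ univ := fun h =>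
  not_exists_frozen_modulus ⟨α, hα, fun t => (h ▸ mem_univ t : t ∈ {t : unitInterval | CardyMod' (cornerCrossingProb t) α})⟩

/-- The route's `Target`, read over the library API (definitional). [folklore] -/
theorem target_iff :
    Target ↔ ∀ t : unitInterval, ∃ α : ℂ, 0 < α.im ∧ CardyMod' (cornerCrossingProb t) α :=
  Iff.rfl

/-- **Openness cannot hold modulus-by-modulus** (refutation, under the route's own Target, of the
strengthening "`∀ α, IsOpen G_α`" of the crux's conclusion `IsOpen (⋃_α G_α)`): the `G_α` are
pairwise disjoint (modulus uniqueness), `G_ζ ∋ 0` and `G_ζ ∌ 1`; if all `G_α` were open, `G_ζ`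
would be a clopen, nonempty, proper subset of the connected `[0,1]`. [folklore] -/
theorem not_forall_isOpen_goodSetAt_of_target (hT : Target) :
    ¬ ∀ α : ℂ, 0 < α.im → IsOpen ({t : unitInterval | CardyMod' (cornerCrossingProb t) α}) := by
  intro hopen
  rw [target_iff] at hT
  have hζ : 0 < triZeta.im := by rw [triZeta_im]; positivity
  have hcompl : ({t : unitInterval | CardyMod' (cornerCrossingProb t) triZeta})ᶜ = ⋃ α ∈ {α : ℂ | 0 < α.im ∧ α ≠ triZeta}, {t : unitInterval | CardyMod' (cornerCrossingProb t) α} := by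
    ext t
    simp only [mem_compl_iff, mem_iUnion, mem_setOf_eq, exists_prop]
    constructor
    · intro ht
      obtain ⟨α, hα, h⟩ := hT t
      exact ⟨α, ⟨hα, fun e => ht (by rw [← e]; exact h)⟩, h⟩
    · rintro ⟨α, ⟨hα, hne⟩, h⟩ hz
      exact hne (modulus_unique' hα hζ h hz)
  have hclosed : IsClosed ({t : unitInterval | CardyMod' (cornerCrossingProb t) triZeta}) := by
    rw [← isOpen_compl_iff, hcompl]
    exact isOpen_biUnion fun α hα => hopen α hα.1
  have hclopen : IsClopen ({t : unitInterval | CardyMod' (cornerCrossingProb t) triZeta}) := ⟨hclosed, hopen _ hζ⟩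
  haveI : PreconnectedSpace unitInterval := Subtype.preconnectedSpace isPreconnected_Icc
  rcases isClopen_iff.1 hclopen with h | h
  · have h0 : (0 : unitInterval) ∈ {t : unitInterval | CardyMod' (cornerCrossingProb t) triZeta} := zero_mem_goodSetAt_triZeta
    rw [h] at h0
    exact h0
  · exact goodSetAt_ne_univ hζ h

/-! ## §3 The side condition `0 < im α` is load-bearing (cheap direction: vacuity for real `α`) -/

/-- For a REAL modulus the shear `φ_α` maps `ℂ` into `ℝ`, so no conformal rectangle (an open,
nonempty subset of `ℂ`) is a `φ_α`-image: `CardyMod' P α` holds VACUOUSLY, for every family `P`.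
[folklore] -/
theorem cardyMod'_of_im_eq_zero (P : ConformalRectangle → ℝ → ℝ) {α : ℂ} (hα : α.im = 0) :
    CardyMod' P α := by
  intro R R' φ x hc hp hu
  exfalso
  obtain ⟨z, hz⟩ := R.isConnected.nonempty
  obtain ⟨ε, hε, hball⟩ := Metric.isOpen_iff.1 R.isOpen z hz
  have him : ∀ w ∈ R.carrier, w.im = 0 := by
    intro w hw
    rw [hc] at hw
    obtain ⟨u, -, rfl⟩ := hw
    rw [moduliShear_im, hα, zero_mul]
  have hmem : z + (ε / 2 : ℝ) * I ∈ R.carrier := by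
    apply hball
    rw [Metric.mem_ball, dist_eq_norm, add_sub_cancel_left, norm_mul, Complex.norm_real,
      Complex.norm_I, mul_one, Real.norm_eq_abs, abs_of_pos (by positivity)]
    linarith
  have h1 := him z hz
  have h2 := him _ hmem
  simp only [add_im, mul_im, ofReal_re, I_im, mul_one, ofReal_im, I_re, mul_zero, add_zero] at h2
  rw [h1, zero_add] at h2
  linarith

/-- Hence, WITHOUT the side condition `0 < im α`, every `t` would be "good" (with `α = 0`): the
condition is what makes the crux's good set, and the Target, non-trivial. [folklore] -/
theorem exists_cardyMod'_real (t : unitInterval) : ∃ α : ℂ, CardyMod' (cornerCrossingProb t) α :=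
  ⟨0, cardyMod'_of_im_eq_zero _ (by simp)⟩

end Summit.CriticalPhenomena.CardyFormulaZ2.Theorems.SegmentOpen.Negative

end
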